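import Literature.NumberTheory.EllipticCurves.DegreeConjectureAbcSemistable
import Literature.NumberTheory.EllipticCurves.SilvermanHeightCovolumeProofs
import Literature.NumberTheory.EllipticCurves.ModularCurveManinConstantProofs
import Literature.NumberTheory.EllipticCurves.DegreeConjectureAbcMurtyProofs
import Literature.NumberTheory.Automorphic.ShimuraCurveRibetTakahashiFreyManinProofs
import Literature.NumberTheory.EllipticCurves.NeronIsogenyScalingHoldsProofs
import Summits.ABC.ABC.Statement
import Summits.ABC.ABC.Theses.DefiniteXi
import Summits.ABC.ABC.Theses.IsogenyGlueCongruence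
import HarnessLib

/-!
# Stub-ideation k1, generation 3 (FAMILY 1 — recognise & import) for `stub_primeToSixDegreeBound`
# (crux `DefiniteXi.SteinbergCore`, stmt-ABC-15024, line `p6_tamagawa_split`): PORTFOLIO TREE-MATCH CERTIFICATE

`P6` is the stub verbatim.  Imports: Literature modules + `Statement` + the two route files ONLY (today's
farm snapshot has the Summits `Theorems/` and `Cruxes/` modules unbuilt: `lean check` rc 75 `unbuilt:` on
`DefiniteXiSteinbergCorePrimeRung`, `IsogenyGlueCongruenceFrameOverPetersson`, the gen-2 workfile — so the
two landed arrows T1/T2 are RE-PROVED here in a few lines instead of cited by import).  NO `sorry`.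

The file certifies, with tree theorems only, that the atom lies in ONE implication class with
* the summit `ABC` (here in `≤`-currency `AbcLe`; `AbcLe ↔ ABC` by `abcLe_of_ABC` / `ABC_of_abcLe`),
* this route's target `DefiniteXi.FreyDegreeBound` (stmt-ABC-2019), and
* the sister route's target `IsogenyGlueCongruence.SemistableDegreeConjecture` (stmt-ABC-2044),
modulo NAMED inputs: Murty's Petersson UPPER bound `PeterssonUpper` (all newforms; for Frey curves it is
discharged from modularity `exists_isNewformOf` by the gen-2 workfile's G1+G2), Pasten Cor. 10.2 +
optimal data + Mazur–Kenku (`FreyManinBound`, T0), and the Petersson LOWER bound = this route's binder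
`DefiniteXi.PeterssonLowerBound`:
* T0 `freyManinBound_of_facts` (composition of tree theorems);
* T1 `p6_of_freyDegreeBound : FreyDegreeBound → P6` (tree copy: `SteinbergCorePrimeRung.primeToSixDegreeBound_of_freyDegreeBound`, p162616);
* T7 `freyDegreeBound_of_abcLe` (Murty Thm 1 (ii) = `abcLe_imp_freyDegreeConjecture_of_petersson_of_manin`);
* T3 `p6_of_abcLe_of_petersson_of_facts : AbcLe → P6` modulo (PeterssonUpper, facts);
* T2 `abcLe_of_igcTarget : PeterssonLowerBound → SemistableDegreeConjecture → AbcLe` (tree copy of IGC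
  `FrameOverPetersson`, stmt-ABC-10885: `c²`-padding + `abcLe_of_semistableDegreeBound`);
* T5 `freyDegreeBound_of_igcTarget`, `p6_of_igcTarget_of_facts` — the CROSS-ROUTE arrows
  stmt-ABC-2044 ⟹ stmt-ABC-2019 ⟹ stub, modulo named inputs;
* T6 (landed, cited only): `SharpDegreeOfPolyDegree.semistableDegreeConjecture_of_abc_of_facts : … → ABC →
  SemistableDegreeConjecture` closes the loop; `P6 ∧ (route binders) → ABC` is the workfile
  `AtomModuloBets.abc_of_primeToSix_of_routeBinders` / tree `SteinbergCorePrimeRung.abc_of_primeRungs` shape.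
Hence no item of the ABC portfolio strictly below abc implies the stub; Family 1 imports NOTHING short of
abc (the only unconditional import is the Stewart–Yu rung, k2 C1).
-/

noncomputable section

set_option linter.dupNamespace false

open scoped MatrixGroups

namespace Summit.ABC.ABC.Cruxes.SteinbergCore.StubIdeas1G3

open Literature.NumberTheory.EllipticCurves Literature.NumberTheory.EllipticCurves.ModularForms
open Literature.NumberTheory.DiophantineGeometry Literature.NumberTheory.Automorphic
open CongruenceSubgroup WeierstrassCurve

/-- The stub, verbatim (`P6TamagawaSplit.stub_primeToSixDegreeBound`). -/
def P6 : Prop :=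
  ∀ ε : ℝ, 0 < ε → ∃ C : ℝ, ∀ a b : ℤ, IsCoprime a b → a * b * (a + b) ≠ 0 → ∀ (N : ℕ) [NeZero N],
    (Literature.NumberTheory.EllipticCurves.freyCurve a b).conductorNorm ℤ = N →
    ∀ D : Literature.NumberTheory.EllipticCurves.ModularForms.ModularParametrizationData
      (Literature.NumberTheory.EllipticCurves.freyCurve a b) N,
      (∀ D' : Literature.NumberTheory.EllipticCurves.ModularForms.ModularParametrizationData
        (Literature.NumberTheory.EllipticCurves.freyCurve a b) N, D.deg ≤ D'.deg) →
      ((D.deg / (ordProj[2] D.deg * ordProj[3] D.deg) : ℕ) : ℝ) ≤ C * (N : ℝ) ^ (2 + ε)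

/-- abc in the `≤`-currency of the Literature theorems (same term as the gen-2 workfiles' `AbcLe`). -/
def AbcLe : Prop :=
  ∀ ε : ℝ, 0 < ε → ∃ C : ℝ, ∀ a b c : ℕ, IsABCTriple a b c →
    (c : ℝ) ≤ C * ((rad a b c : ℕ) : ℝ) ^ (1 + ε)

/-- The summit (strict form, `0 < C`) gives the `≤`-form. [folklore] -/
theorem abcLe_of_ABC (h : _root_.ABC) : AbcLe := by
  intro ε hε
  obtain ⟨C, -, hC⟩ := (ABC_iff.mp h) ε hε
  exact ⟨C, fun a b c habc => (hC a b c habc).le⟩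

/-- … and conversely (`abcLt_of_abcLe`, `C ↦ max C 0 + 1`). [folklore] -/
theorem ABC_of_abcLe (h : AbcLe) : _root_.ABC :=
  ABC_iff.mpr (abcLt_of_abcLe h)

/-- Murty's Petersson UPPER bound `(f,f) ≤ C₂(η) N^{1+η}` for the newform of every elliptic curve over
`ℚ`, every `η > 0` (verbatim the hypothesis `hUp` of `abcLe_imp_freyDegreeConjecture_of_petersson_of_manin`;
NOT a tree theorem for all curves — for FREY curves it is the gen-2 workfile's G1
`freyPeterssonUpper_of_modularity (hmod : exists_isNewformOf)`). -/
def PeterssonUpper : Prop :=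
  ∀ η : ℝ, 0 < η → ∃ C₂ : ℝ, ∀ (N : ℕ) [NeZero N] (W : WeierstrassCurve ℚ) [W.IsElliptic]
    (f : CuspForm (Gamma0 N) 2), IsNewformOf W f →
      (peterssonProduct (Gamma0 N) 2 f f).re ≤ C₂ * (N : ℝ) ^ (1 + η)

/-- Uniformly bounded Manin constants on the Frey curves (Murty's `hM`). -/
def FreyManinBound : Prop :=
  ∃ M : ℕ, ∀ a b : ℤ, IsCoprime a b → a * b * (a + b) ≠ 0 →
    ∀ (N : ℕ) [NeZero N], (freyCurve a b).conductorNorm ℤ = N →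
      ∃ D : ModularParametrizationData (freyCurve a b) N, D.maninConstant.natAbs ≤ M

/-- **T0 (PROVED, composition of tree theorems)**: `FreyManinBound` from Pasten Cor. 10.2, optimal data
and Mazur–Kenku; the Néron-scaling input is the tree theorem
`integral_neronScaling_of_isGloballyMinimal_holds`. [cite: PastenShimura2024, Cor. 10.2 and Rem. 3.3] -/
theorem freyManinBound_of_facts (h102 : PastenShimura2024_cor_10_2)
    (hopt : exists_optimal_modularParametrizationData) (hMK : mazurKenku_exists_cyclic_isogeny) :
    FreyManinBound :=
  PastenShimura2024_cor_10_2.exists_freyCurve_datum_maninConstant_le h102 hopt hMK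
    integral_neronScaling_of_isGloballyMinimal_holds

/-- **T1 (PROVED; tree copy of `SteinbergCorePrimeRung.primeToSixDegreeBound_of_freyDegreeBound`,
p162616)**: the route target gives the atom — a minimal datum has degree at most that of the datum
`FreyDegreeBound` provides, and `cps n ≤ n`. [folklore] -/
theorem p6_of_freyDegreeBound (hX : Summit.ABC.ABC.Theses.DefiniteXi.FreyDegreeBound) : P6 := by
  intro ε hε
  obtain ⟨C, hC⟩ := hX ε hε
  refine ⟨C, fun a b hab h0 N _ hN D hDmin => ?_⟩
  obtain ⟨D₀, hD₀⟩ := hC a b hab h0 N hN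
  have h0' : (((D.deg / (ordProj[2] D.deg * ordProj[3] D.deg) : ℕ) : ℝ)) ≤ (D.deg : ℝ) := by
    exact_mod_cast Nat.div_le_self _ _
  have h1 : (D.deg : ℝ) ≤ (D₀.deg : ℝ) := by exact_mod_cast hDmin D₀
  exact h0'.trans (h1.trans hD₀)

/-- **T7 (PROVED)**: `AbcLe ⟹ FreyDegreeBound` modulo `PeterssonUpper` and `FreyManinBound` — Murty's
Theorem 1 (ii) as the tree theorem `abcLe_imp_freyDegreeConjecture_of_petersson_of_manin`
(`D.modularDegree = D.deg` by `rfl`). [cite: MurtyCongruencePrimes1999, Thm. 1 (ii)] -/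
theorem freyDegreeBound_of_abcLe (hUp : PeterssonUpper) (hM : FreyManinBound) (h : AbcLe) :
    Summit.ABC.ABC.Theses.DefiniteXi.FreyDegreeBound := by
  intro ε hε
  obtain ⟨C, hC⟩ := abcLe_imp_freyDegreeConjecture_of_petersson_of_manin hUp hM h ε hε
  refine ⟨C, fun a b hab h0 N _ hN => ?_⟩
  obtain ⟨D, hD⟩ := hC a b hab h0 N hN
  exact ⟨D, hD⟩

/-- **T3 (PROVED)**: `AbcLe ⟹ P6` modulo `PeterssonUpper` and the three named facts (the gen-2 engine
`p6_of_ABC_of_petersson_of_facts` in `≤`-currency, so that it composes with any `≤`-form source of abc,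
e.g. T2). [cite: MurtyCongruencePrimes1999, Thm. 1 (ii)] -/
theorem p6_of_abcLe_of_petersson_of_facts (hUp : PeterssonUpper) (h102 : PastenShimura2024_cor_10_2)
    (hopt : exists_optimal_modularParametrizationData) (hMK : mazurKenku_exists_cyclic_isogeny)
    (h : AbcLe) : P6 :=
  p6_of_freyDegreeBound (freyDegreeBound_of_abcLe hUp (freyManinBound_of_facts h102 hopt hMK) h)

/-- **T3'**: the same from the summit. -/
theorem p6_of_ABC_of_petersson_of_facts (hUp : PeterssonUpper) (h102 : PastenShimura2024_cor_10_2)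
    (hopt : exists_optimal_modularParametrizationData) (hMK : mazurKenku_exists_cyclic_isogeny)
    (h : _root_.ABC) : P6 :=
  p6_of_abcLe_of_petersson_of_facts hUp h102 hopt hMK (abcLe_of_ABC h)

/-- **T2 (PROVED; tree copy of IGC `FrameOverPetersson`, stmt-ABC-10885)**: the sister route's TARGET
`SemistableDegreeConjecture` (stmt-ABC-2044) plus the Petersson lower bound give abc in `≤`-currency:
`c²`-padding (`c ∈ ℤ ∖ {0}`, `maninConstant_ne_zero_holds`) then `abcLe_of_semistableDegreeBound`
(Zagier identity + Silverman covolume, `silverman1986_discriminant_c4_covolume_holds`).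
[cite: MurtyCongruencePrimes1999, Thm. 1 (i)] -/
theorem abcLe_of_igcTarget (hP : murty_petersson_newform_lower_bound)
    (hX : Summit.ABC.ABC.Theses.IsogenyGlueCongruence.SemistableDegreeConjecture) : AbcLe := by
  refine abcLe_of_semistableDegreeBound hP silverman1986_discriminant_c4_covolume_holds ?_
  intro ε hε
  obtain ⟨C, hC⟩ := hX ε hε
  refine ⟨max C 0, fun W _ _ _ hss ↦ ?_⟩
  obtain ⟨D, hD⟩ := hC W hss
  have hD' : (D.deg : ℝ) ≤ C * ((W.conductorNorm ℤ : ℕ) : ℝ) ^ (2 + ε) := hD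
  refine ⟨D, hD'.trans ?_⟩
  have hc : (1 : ℝ) ≤ (D.c : ℝ) ^ 2 := by
    have h1 : (1 : ℤ) ≤ D.c ^ 2 := by
      have h0 : D.c ≠ 0 := D.maninConstant_ne_zero_holds
      nlinarith [Int.one_le_abs h0, sq_abs D.c]
    exact_mod_cast h1
  have hN0 : (0 : ℝ) ≤ ((W.conductorNorm ℤ : ℕ) : ℝ) ^ (2 + ε) := by positivity
  calc C * ((W.conductorNorm ℤ : ℕ) : ℝ) ^ (2 + ε)
      ≤ max C 0 * ((W.conductorNorm ℤ : ℕ) : ℝ) ^ (2 + ε) :=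
        mul_le_mul_of_nonneg_right (le_max_left _ _) hN0
    _ = max C 0 * 1 * ((W.conductorNorm ℤ : ℕ) : ℝ) ^ (2 + ε) := by ring
    _ ≤ max C 0 * (D.c : ℝ) ^ 2 * ((W.conductorNorm ℤ : ℕ) : ℝ) ^ (2 + ε) :=
        mul_le_mul_of_nonneg_right (mul_le_mul_of_nonneg_left hc (le_max_right C 0)) hN0

/-- **T2'**: the Petersson input is verbatim THIS route's binder `DefiniteXi.PeterssonLowerBound`
(stmt-ABC item of route DefiniteXi; same term as `murty_petersson_newform_lower_bound`). -/
theorem abc_of_igcTarget (hP : Summit.ABC.ABC.Theses.DefiniteXi.PeterssonLowerBound)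
    (hX : Summit.ABC.ABC.Theses.IsogenyGlueCongruence.SemistableDegreeConjecture) : _root_.ABC :=
  ABC_of_abcLe (abcLe_of_igcTarget hP hX)

/-- **T5a (PROVED; cross-route arrow stmt-ABC-2044 ⟹ stmt-ABC-2019)**: the sister route's target gives
THIS route's target, modulo `PeterssonLowerBound`, `PeterssonUpper` and the named facts. -/
theorem freyDegreeBound_of_igcTarget (hP : Summit.ABC.ABC.Theses.DefiniteXi.PeterssonLowerBound)
    (hUp : PeterssonUpper) (h102 : PastenShimura2024_cor_10_2)
    (hopt : exists_optimal_modularParametrizationData) (hMK : mazurKenku_exists_cyclic_isogeny)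
    (hX : Summit.ABC.ABC.Theses.IsogenyGlueCongruence.SemistableDegreeConjecture) :
    Summit.ABC.ABC.Theses.DefiniteXi.FreyDegreeBound :=
  freyDegreeBound_of_abcLe hUp (freyManinBound_of_facts h102 hopt hMK) (abcLe_of_igcTarget hP hX)

/-- **T5b (PROVED; cross-route arrow stmt-ABC-2044 ⟹ the stub)**. -/
theorem p6_of_igcTarget_of_facts (hP : Summit.ABC.ABC.Theses.DefiniteXi.PeterssonLowerBound)
    (hUp : PeterssonUpper) (h102 : PastenShimura2024_cor_10_2)
    (hopt : exists_optimal_modularParametrizationData) (hMK : mazurKenku_exists_cyclic_isogeny)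
    (hX : Summit.ABC.ABC.Theses.IsogenyGlueCongruence.SemistableDegreeConjecture) : P6 :=
  p6_of_freyDegreeBound (freyDegreeBound_of_igcTarget hP hUp h102 hopt hMK hX)

/- **T6 (LANDED; cited, not re-elaborated — its module is behind the unbuilt snapshot)**: conversely the
summit gives the sister target modulo facts,
`Summit.ABC.ABC.Theorems.SharpDegreeOfPolyDegree.semistableDegreeConjecture_of_abc_of_facts
  (hOpt : exists_optimal_modularParametrizationData)
  (hc1 : ∀ {N} [NeZero N] {W₀} (D₀ : ModularParametrizationData W₀ N), D₀.abs_maninConstant_eq_one_of_isSemistable)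
  (hMK : IsogenyGlueCongruence.MazurKenkuBound) (h : ABC) : IsogenyGlueCongruence.SemistableDegreeConjecture`
(module `Summits.ABC.ABC.Theorems.IsogenyGlueCongruenceSharpDegreeOfPolyDegreeOfAbc`), and
`P6 → (DefiniteXi binders) → ABC` is `Cruxes/SteinbergCore/AtomModuloBets.lean` /
`SteinbergCorePrimeRung.abc_of_primeRungs`: the class `{P6, FreyDegreeBound, SemistableDegreeConjecture, ABC}`
is closed modulo named inputs and this route's binders. -/

end Summit.ABC.ABC.Cruxes.SteinbergCore.StubIdeas1G3

end
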